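import Summits.NavierStokesRegularity.NavierStokesRegularity.Theorems.ExtremalBiaxialitySubcritical.Negative.ExactStrainFlows
import Summits.NavierStokesRegularity.NavierStokesRegularity.Theorems.ExtremalBiaxialitySubcritical.Negative.SelfSimilarStrain
import Summits.NavierStokesRegularity.NavierStokesRegularity.Theorems.ExtremalBiaxialitySubcritical.Negative.Saddle
import Summits.NavierStokesRegularity.NavierStokesRegularity.Theorems.ExtremalBiaxialitySubcritical.Negative.LoadBearing
import Summits.NavierStokesRegularity.NavierStokesRegularity.Theorems.ExtremalBiaxialitySubcritical.Negative.MaximalityFree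
import Summits.NavierStokesRegularity.NavierStokesRegularity.Theorems.SqueezeCycleExtremalBiaxialitySubcriticalExtremal
import Summits.NavierStokesRegularity.NavierStokesRegularity.Theorems.SqueezeCycleStrainAlgebra
import Literature.Analysis.FluidPDE.LerayGaugeStrainSpectrum

/-!
# Disproof of `ExtremalBiaxialitySubcritical` — findings (cdisprove work file, generation 3)

Crux `stmt-NavierStokesRegularity-11609` =
`Summit.NavierStokesRegularity.NavierStokesRegularity.Theses.SqueezeCycle.ExtremalBiaxialitySubcritical`
(route `SqueezeCycle`, rank 2, "no perpetual squeeze machine"):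

  `∀ C m u t₀ x₀, t₀ < 0 → u ∈ 𝒦_C → LamGE m u t₀ x₀ → IsClassMax C m → m < 1/8`

where `𝒦_C` (`InK C u` below, VERBATIM the route's inline class) is the Type-I KNSS-mild ancient
class (H1 joint smoothness on `t < 0`, H2 `div = 0`, H3 the Oseen/KNSS-mild identity written
through `heatKernel`, H4 `‖u(t,x)‖ ≤ C/√(−t)`, H5 scaled energies `≤ C`), `LamGE m u t₀ x₀` is the
Courant–Fischer two-frame form of "`Λ_u(t₀,x₀) ≥ m`" for the Leray-gauge middle strain eigenvalue
`Λ = (−t)λ₂(sym ∇u)` (= the tree's `lerayMiddleStrain`, `le_lerayMiddleStrain_iff`), and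
`IsClassMax C m` says `Λ_{v'} ≤ m` at every point of every `v' ∈ 𝒦_C` (`lerayMiddleStrain_le_iff`).

VERDICT AFTER THREE CYCLES: **no kill, and none is available by cheap means.** Generation 3
settles the LOGICAL GEOMETRY of the crux completely, using the now-PROVED compactness item
`ExtremalElementExists` (p70643, `exists_extremal_lerayMiddleStrain`):
* `crux_iff_withoutMaximality'` (§5): the maximality clause is FREE — the crux is equivalent to
  the pointwise a-priori bound "`Λ_u(t,x) < 1/8` at every point of every element of every `𝒦_C`";
* `not_crux_iff_point` (§5): a refutation is EXACTLY one element of one `𝒦_C` with `Λ ≥ 1/8` at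
  ONE point — no extremal element, no class comparison needed (and by `squeezeClass_mono` the same
  then holds in every larger class); such an element is a nontrivial Type-I ancient KNSS-mild
  solution with bounded scaled energies (open: KNSS / Seregin–Šverák / Albritton–Barker Liouville
  problem; Bradshaw–Tsai 2017 OP 5.1 for the DSS sub-case; every symmetric sub-case excluded);
* `classMax_attained'` (§5): for EVERY `C ≥ 0` a genuine maximiser exists, so the hypotheses of the
  crux are satisfied non-vacuously at `m = max_{𝒦_C} Λ`, and the crux reads `max_{𝒦_C} Λ < 1/8 ∀C`;
* `squeezeLiouville_iff'` (§6): **X ⇔ MustSqueeze ∧ crux** — the two open cruxes partition the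
  target with NO SLACK; given the `MustSqueeze` family below `1/4`, `max_{𝒦_C} Λ ∈ {0} ∪ [1/4, ∞)`
  (`classMax_gap'`) and X itself ⇔ "`Λ < 1/4` on every `𝒦_C`" (§6);
* the picked line's bootstrap disposes only of attained maxima in `[1/4, 0.28)` (§6,
  `largeExcess_*`): its open stub is the crux on `m ≥ 0.28`;
* **any finite-energy Type-I blow-up refutes the crux automatically** (§7, `not_crux_of_typeI_blowup`,
  via the quarter law run in PHYSICAL variables where enstrophy is finite), and `MustSqueeze` is
  bypassable in the route (`clay_of_crux_sans_mustSqueeze`).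
Everything below is certified Lean (no `sorry`); the conclusive parts are LANDED under
`Theorems/ExtremalBiaxialitySubcritical/Negative/` (gen 2: p71597 `ExactStrainFlows`, p71639
`Saddle`, p71711 `LoadBearing`, p71889 `SelfSimilarStrain`; gen 3: p72559 `MaximalityFree`, p72873
`NoSlack`, p73386 `QuarterLawBypass`) and are imported here — ideators / planners / the lead may
import them too.

## Index of findings

### Generation 1 (cycle 1, 2026-08-15; its work file lived only in gate evidence — reconstructed)
* read-back `crux_iff` / `inK_iff` / `lamGE_iff` / `lamLE_iff` (§0 here, re-proved);
* load-bearing: `false_without_time`, `false_without_membership` (then with `u = x`, `C < 0`),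
  `false_without_attainment`, `WithoutMaximality` Liouville-hard both ways (§1 here, re-proved
  with stronger witnesses and LANDED, p71711 / p71597);
* calibration: `m ≥ 0` forced (`nonneg_of_maximal`, now the tree's), `m < 0` refuted, hypotheses
  satisfiable (`C = m = 0`, `u ≡ 0`), crux true for `C ≤ 0`, `C ≤ ε` and under `SqueezeLiouville`
  / `TypeIAncientLiouville` / (L) (all now tree theorems: `…OfLiouville`, `…SmallConstant`,
  `…Reductions`), the threshold `1/8` irrelevant to the truth value, content at `C > 0`;
* mechanism probes: `biaxialM_balance` (restricted-Euler fixed point `diag(1,1,−2)`, `Λ = 1`),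
  `strainU_mid_neg` / `strainU_11_laplacian` (the card's "viscous ≤ 0" is FALSE for `λ₂`: a
  div-free cubic field with a strict local max of `λ₂(S)` at `0` and `e₂ᵀΔS e₂ = +3`),
  `six_mul_middle_sq_le` (`6λ₂² ≤ |S|²`, now the tree's `six_mul_midStrain_sq_le`),
  `localBudget_witness_one_eighth` (first-order budget closes at `m = 1/8`).

### Generation 2 (cycle 2, 2026-08-16) — this file
* **(A) Perpetual squeeze machines just outside the class** (LANDED p71597 `ExactStrainFlows`,
  p71889 `SelfSimilarStrain`): for EVERY smooth amplitude `c`, `u_c(t,x) = c(t)·(x₀, x₁, −2x₂)`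
  with `p = −½c'xᵀDx − ½c²|Dx|²` is an exact classical Navier–Stokes flow
  (`IsClassicalNSSolutionOn (Iio 0) 1 0`, certified) whose Leray-gauge middle strain eigenvalue is
  `Λ(t,x) = (−t)c(t)` at EVERY point (both two-frame clauses of the crux, verbatim). So the gauge
  history of `Λ` along an exact flow is an ARBITRARY smooth function of time, constant in space:
  `pulsedStrain m` (`c = (2+t)m`): one record `m` at `t = −1`, `Λ ≤ m` everywhere, regular at
  `t = 0`; `selfSimilarStrain m` (`c = m/(−t)`, Leray's self-similar ansatz with LINEAR profile):
  `Λ ≡ m` on `ℝ³ × (−∞,0)`, every point a record, DSS for every factor, singular at `0`. At the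
  pulse's record the gauge gradient is `m·diag(1,1,−2)`, `Ω = 0`, `𝒱 = 0` and (for `m = 1`) the
  pressure Hessian `−D − D² = −2·Id` is ISOTROPIC: the Vieillefosse fixed point of cycle 1, dressed
  by the far field into a global exact flow. Consequences:
  - `not_selfExtremal` (§1): membership → "exact NS flow", class-maximality → maximality over ALL
    space-time points of `u` itself (= over the whole admissible symmetry ORBIT of `u`: scaling,
    translations, rotations fix `Λ`, past shifts lower it) ⇒ FALSE for every `m > 0`. HENCE: no
    argument from optimality at the record — first order (cycle 1's B2), second order, any finite
    jet, or comparison along the flow — can bound `m`, even with the exact dynamics; every proof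
    must use the far-field/integrability content of `𝒦_C` (H3–H5) or genuinely DIFFERENT
    competitors.
  - `false_without_membership_zero/_small/_of_squeezeLiouville` (§1): keep the GENUINE
    class-maximality clause, drop only membership of the extremal element (→ exact NS flow):
    FALSE at `C = 0`, at every `C ≤ ε`, and at every `C` under the route target. Membership is
    load-bearing exactly where the crux has content, and in the Liouville world the crux is true
    ONLY because membership forces `Λ ≡ 0`.
* **(B) Saddle no-go** (LANDED p71639 `Saddle`): explicit trace-free symmetric `S₀ ± H`, `S₁ ± H'`
  with two-frame certificates: `λ₂(S₀) ≥ 9/5 > 0 ≥ λ₂(S₀ ± H)` and `λ₂(S₁) ≤ −9/5 < 0 ≤ λ₂(S₁ ± H')`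
  — `λ₂` is neither midpoint-convex nor midpoint-concave, `Λ` is neither a sub- nor a supersolution
  of the linear part of the strain equation: maximum/minimum-principle, comparison, Harnack and
  strong-max lines on `Λ` are structurally void (the triage's request; the reason behind cycle 1's
  `strainU_*`).
* **(C) The first-order record budget closes for every `m`** (LANDED p71639): with `Ω = 0`,
  `ℌ^dev = 0` and DISSIPATIVE `𝒱 ≤ 0`, by the shape `diag(km, m, −(k+1)m)`, `k ≥ k*(m) =
  (−1+√(3+6/m))/2` (`k*(1) = 1`, `k*(1/4) ≈ 2.10`, `k*(1/8) ≈ 3.07`) — supersedes cycle 1's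
  `m = 1/8` witness now that the content sits at `m ≥ 1/4`.
* **(D) Load-bearing hypotheses, clauses verbatim** (LANDED p71711 `LoadBearing`):
  `squeezeClass_congr` (𝒦_C sees only `t < 0`), `false_without_attainment` (`C = 0`, `u ≡ 0`,
  `m = 1`), `false_without_time` (junk slice at `t₀ = 1`), `withoutMaximality_of_squeezeLiouville`
  / `squeezeLiouville_of_mustSqueeze_of_withoutMaximality` (drop maximality = the Liouville
  problem).

### Generation 3 (cycle 3, 2026-08-16) — this file, §5–§7 (LANDED p72559 `MaximalityFree`, p72873 `NoSlack`, p73386 `QuarterLawBypass`)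
* **(E) Maximality is free.** `ExtremalElementExists` is a theorem (p70643), hence:
  `squeezeClass_mono` (`𝒦_C ⊆ 𝒦_{C'}`), `classMax_attained` (∀ `C ≥ 0` ∃ maximiser, `m ≥ 0`),
  `lerayMiddleStrain_lt_of_crux` (crux ⇒ `Λ < 1/8` everywhere on every class),
  `crux_iff_withoutMaximality`, `crux_iff_forall_lerayMiddleStrain_lt`,
  `not_crux_iff_exists_point` / `not_crux_iff_eventually` (kill shape = ONE point with `Λ ≥ 1/8`),
  `classMax_gap` (`m ≤ 0 ∨ m ≥ 1/4` given the MustSqueeze family),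
  `crux_iff_forall_lerayMiddleStrain_lt_quarter`.
  CONSEQUENCE FOR PROVERS: assuming an extremal element costs nothing and restricts nothing — any
  proof may start from a maximiser normalised to `(−1, 0)` (tree `extremal_normalise`), rooted
  (`extremal_not_future_shift_mem`), with `Λ = m = max ≥ 1/4`; but the statement to be proved is
  an a-priori bound on ALL of `𝒦_C`, so arguments must ultimately be class-wide (Liouville type).
  CONSEQUENCE FOR DISPROVERS: the maximality clause is no obstacle and no help; the only route to
  a kill is an explicit / certified nontrivial Type-I ancient solution.
* **(F) No slack** (LANDED p72873 `NoSlack`). `squeezeLiouville_iff_mustSqueeze_and_crux` (X ⇔ MustSqueeze ∧ crux),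
  `crux_iff_squeezeLiouville` (under MustSqueeze the crux IS X), `mustSqueeze_iff_squeezeLiouville`,
  `squeezeLiouville_iff_forall_lerayMiddleStrain_lt_quarter` (given the MS family, X ⇔ `Λ < 1/4`
  on every class). Which of the two cruxes carries the open problem depends only on the values of
  `Λ` on hypothetical nontrivial Type-I ancient solutions: if any has `sup Λ ≥ 1/4` (what the
  quarter law predicts for every finite-enstrophy profile, and what DSS profiles must have by
  time-averaging `½Z' + ‖∇Ω‖² + ¼Z = ∫ΩSΩ` over a period), the crux is false and MustSqueeze moot;
  if all have `Λ ≤ 1/8`, MustSqueeze is false and the crux true. Either way X fails. — RESOLVED by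
  (I) below for solutions arising from finite-energy blow-up: those always have `sup Λ ≥ 1/4`, so the
  crux carries the Type-I half of the Clay problem on the nose.
* **(G) How much the picked line buys.** `cubicCeiling_eq_of_pinned` (the cubic ceiling of
  `stub_cubicProductionBound` is an EQUALITY whenever `λ₂ = m`, `|S| = K`: excess `b = m − 2m³/K²`
  sharp), `largeExcess_of_three_eighths_le` (open regime ⊇ all attained `m ≥ 3/8`),
  `largeExcess_of_strainFloor` (⊇ `m ≥ 0.28` once `K² ≥ 3/2`, the no-slack strain floor of any
  nontrivial class), `largeExcess_of_window` (general: `2m³ ≤ (m − 1/4)K²`). The bootstrap's new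
  mathematics lives in the sliver `[1/4, 0.28)`; `stub_largeExcessExclusion` is the crux on the rest.
* **(I) Physical quarter law ⇒ MustSqueeze bypassable** (LANDED p73386 `QuarterLawBypass`, §7):
  `not_crux_of_typeI_blowup`, `not_crux_of_blowup`, `clay_of_crux_sans_mustSqueeze` with the two
  analytic inputs (Q) `PhysicalQuarterLaw` (Miller 2019 Thm 1.1 at `q = ∞` + Leray's `Ḣ¹` rate;
  finite enstrophy, no localisation) and (Z) `SqueezeZoom` (Albritton–Barker 2019 Lemma 2.5 with
  `L^{2,∞}_t L^∞_x`, KNSS compactness) inlined as hypotheses. Converse (¬ finite-energy Type-I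
  blow-up ⇒ crux) NOT available: Albritton–Barker's equivalence (Thm 1.1, arXiv:1811.00502) is for
  the class `𝐈 < ∞` and they note the sup-rate class is "not well suited to the reverse direction".
* **(H) Literature sweep 2024–2026** (search services degraded in gen 1–2; see NOTES of gen 3 for
  the query log): no Liouville theorem for Type-I ancient / bounded ancient mild solutions beyond the
  symmetric classes, no construction of a nontrivial one, no ancient / Type-I statement involving
  the middle strain eigenvalue (Miller-type results remain `L^p_t L^q_x` criteria). Status of the
  kill shape: open both ways.

## Why it resists (for the provers) — where the content is
1. The only thing wrong with the machines of (A) is their unbounded far field: linear velocity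
   growth supplies an anisotropic pressure Hessian `−c'(t)D` of ANY prescribed time profile at the
   record. In `𝒦_C` the deviatoric pressure Hessian at `x₀` is the `P₂`-quadrupole transform of
   `q = ½|Ω|² − |𝔖|²` (card `oseen-shell-polar-tomography`, lever (ii)) and the far shell beyond
   gauge radius `K` contributes `≤ c₀C²(1+log K)/K²` (lever (i), Type-I sup bound). THAT is the
   crux's content: a bill of size `m(1+m) − [RE self-payment]` must be paid from within `K(C, m)`
   by sub-maximal structure. Lines that do not spend H3–H5 quantitatively prove nothing (A, B, C).
2. By (B) no scalar functional of the form `Λ = (−t)λ₂` admits a maximum principle; convex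
   surrogates (`λ₁`, `λ₁+λ₂`, Ky Fan) do, but by the triage's no-slack fact every nontrivial
   element has `sup (−t)λ₁ ≥ 1`, so convex transfers are the TARGET in other words.
3. By the bootstrap (`extremalBiaxialitySubcritical_bootstrap`, tree) the content is at attained
   `m ≥ 1/4` (+ `δ₀(C)` per triage r1-3), `C > ε`; (C) says the record budget there is
   self-payable for `k ≥ 2.1`: the extremal element may squeeze ITSELF (auto-squeeze), so
   "somebody else pays" is not forced either.
4. Kill shape (`not_crux_iff`): a nontrivial `u ∈ 𝒦_C`, i.e. ¬(Type-I Liouville). Nothing in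
   print; every symmetric sub-case is excluded (tree `…Symmetric`); DSS open (OP 5.1).
5. (gen 3) Kill shape sharpened (`not_crux_iff_point`): ONE point with `Λ ≥ 1/8` in ONE element of
   ONE class — maximality is free (`crux_iff_withoutMaximality'`). The crux is an a-priori bound on
   the whole Type-I class; with MustSqueeze it IS the target (`squeezeLiouville_iff'`). There is no
   statement strictly between the crux and X that the route could retreat to: every weakening of
   the crux that keeps the route closed is X-hard on the nose.

## Not certified / numerics only
* A HARMONIC quartic `ψ = x₀² + ½x₁² − (3/2)x₂² + x₁(x₀² − x₂²) − x₁⁴/12 + (3/2)x₀²x₁² − x₁²x₂²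
  − x₀⁴/4 + x₂⁴/6` has `λ₂(Hess ψ)(x) = 1 − |x|² + O(|x|³)` (second-order perturbation: level
  repulsion `−(2x₀)²/(2−1)` beats `+(2x₂)²/(1+3)`; pure-python check `scratch/harmonic_max.py`:
  `max_{|x|=r} λ₂ < 1` for `0 < r ≤ 0.15`), so even a STRICT spatial maximum of `λ₂` is realised
  by an exact steady potential flow `u = ∇ψ`: spatial second-order conditions at the record are
  void too. Not formalised (eigenvalue perturbation theory absent from Mathlib); superseded by (A).
-/

noncomputable section

open Set Function Filter MeasureTheory
open scoped RealInnerProductSpace Matrix Topology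

set_option linter.dupNamespace false

namespace Summit.NavierStokesRegularity.NavierStokesRegularity.Cruxes.ExtremalBiaxialitySubcritical.Disproof

open Literature.Analysis.FluidPDE
open Summit.NavierStokesRegularity.NavierStokesRegularity.Theses
open Summit.NavierStokesRegularity.NavierStokesRegularity.Theorems
open Summit.NavierStokesRegularity.NavierStokesRegularity.Theorems.ExtremalBiaxialitySubcritical

/-- Physical space. -/
local notation "ℝ³" => EuclideanSpace ℝ (Fin 3)

/-! ## §0 Read-back: the crux, named -/

/-- `InK C u`: the crux's inline Type-I model class `𝒦_C`, VERBATIM. -/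
def InK (C : ℝ) (u : ℝ → EuclideanSpace ℝ (Fin 3) → EuclideanSpace ℝ (Fin 3)) : Prop :=
  ContDiffOn ℝ (⊤ : ℕ∞) (Function.uncurry u) (Set.Iio 0 ×ˢ Set.univ) ∧ (∀ t < 0, Literature.Analysis.FluidPDE.VectorCalculus.IsDivFree (u t)) ∧ (∀ s t : ℝ, s < t → t < 0 → ∀ x, u t x = Literature.Analysis.FluidPDE.heatFlow (u s) (t-s) x - ∫ τ in Set.Ioo s t, ∫ y, ((-(inner ℝ (x-y) (u τ y) / (2*(t-τ)) * Literature.Analysis.UnboundedOperators.heatKernel (t-τ) (x-y))) • u τ y + (∫ σ in Set.Ioi (t-τ), Literature.Analysis.UnboundedOperators.heatKernel σ (x-y) / (4*σ^2)) • (inner ℝ (x-y) (u τ y) • u τ y + inner ℝ (u τ y) (u τ y) • (x-y) + inner ℝ (x-y) (u τ y) • u τ y) - ((∫ σ in Set.Ioi (t-τ), Literature.Analysis.UnboundedOperators.heatKernel σ (x-y) / (8*σ^3)) * (inner ℝ (x-y) (u τ y) * inner ℝ (x-y) (u τ y))) • (x-y))) ∧ Literature.Analysis.FluidPDE.HasTypeITimeDecay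 C u ∧ (∀ (x₀ : EuclideanSpace ℝ (Fin 3)) (t₀ r : ℝ), t₀ ≤ 0 → 0 < r → (∀ t, t₀ - r^2 < t → t < t₀ → r⁻¹ * ∫ x in Metric.ball x₀ r, ‖u t x‖^2 ≤ C) ∧ r⁻¹ * ∫ t in Set.Ioo (t₀ - r^2) t₀, ∫ x in Metric.ball x₀ r, ‖fderiv ℝ (u t) x‖^2 ≤ C)

/-- `LamGE m u t₀ x₀`: "`Λ_u(t₀,x₀) ≥ m`", the crux's lower two-frame clause, VERBATIM. -/
def LamGE (m : ℝ) (u : ℝ → ℝ³ → ℝ³) (t₀ : ℝ) (x₀ : ℝ³) : Prop :=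
  ∃ v w : EuclideanSpace ℝ (Fin 3), ‖v‖ = 1 ∧ ‖w‖ = 1 ∧ inner ℝ v w = 0 ∧ ∀ α β : ℝ, m * (α^2 + β^2) ≤ (-t₀) * inner ℝ (fderiv ℝ (u t₀) x₀ (α • v + β • w)) (α • v + β • w)

/-- `LamLE m u t x`: "`Λ_u(t,x) ≤ m`", the crux's upper two-frame clause, VERBATIM. -/
def LamLE (m : ℝ) (u : ℝ → ℝ³ → ℝ³) (t : ℝ) (x : ℝ³) : Prop :=
  ∃ v w : EuclideanSpace ℝ (Fin 3), ‖v‖ = 1 ∧ ‖w‖ = 1 ∧ inner ℝ v w = 0 ∧ ∀ α β : ℝ, (-t) * inner ℝ (fderiv ℝ (u t) x (α • v + β • w)) (α • v + β • w) ≤ m * (α^2 + β^2)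

/-- `IsClassMax C m`: class-maximality of the value `m` over `𝒦_C`, VERBATIM. -/
def IsClassMax (C m : ℝ) : Prop :=
  ∀ v' : ℝ → EuclideanSpace ℝ (Fin 3) → EuclideanSpace ℝ (Fin 3), InK C v' → ∀ t < 0, ∀ x, LamLE m v' t x

/-- **Read-back** (definitional): the crux is `∀ C m u t₀ x₀, t₀ < 0 → InK C u → LamGE m u t₀ x₀ →
IsClassMax C m → m < 1/8`. -/
theorem crux_iff :
    SqueezeCycle.ExtremalBiaxialitySubcritical ↔
      ∀ (C m : ℝ) (u : ℝ → ℝ³ → ℝ³) (t₀ : ℝ) (x₀ : ℝ³), t₀ < 0 → InK C u → LamGE m u t₀ x₀ →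
        IsClassMax C m → m < 1 / 8 :=
  Iff.rfl

/-- The inline class is the tree's `IsTypeIAncientMild` plus the scaled-energy clause
(`isTypeIAncientMild_of_squeezeClass`). -/
theorem InK.isTypeIAncientMild {C : ℝ} {u : ℝ → ℝ³ → ℝ³} (h : InK C u) : IsTypeIAncientMild C u :=
  isTypeIAncientMild_of_squeezeClass h.1 h.2.1 h.2.2.1 h.2.2.2.1

/-- **Two-frame clauses = eigenvalue inequalities** (Courant–Fischer, tree bridges): for `t < 0`,
`LamGE m u t x ↔ m ≤ Λ_u(t,x)`. -/
theorem lamGE_iff {m t : ℝ} (ht : t < 0) {u : ℝ → ℝ³ → ℝ³} {x : ℝ³} :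
    LamGE m u t x ↔ m ≤ lerayMiddleStrain u t x :=
  (le_lerayMiddleStrain_iff ht m).symm

/-- … and `LamLE m u t x ↔ Λ_u(t,x) ≤ m`. -/
theorem lamLE_iff {m t : ℝ} (ht : t < 0) {u : ℝ → ℝ³ → ℝ³} {x : ℝ³} :
    LamLE m u t x ↔ lerayMiddleStrain u t x ≤ m :=
  (lerayMiddleStrain_le_iff ht m).symm

/-- **Kill shape.** The crux fails iff some `𝒦_C` has an element attaining a class-maximal
Leray-gauge middle eigenvalue `m ≥ 1/8` at an interior point — necessarily a NONTRIVIAL element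
(`Λ_0 ≡ 0`), with `C > ε` (`extremalBiaxialitySubcritical_of_small`) and, given the `MustSqueeze`
family below `1/4`, `m ≥ 1/4` (`extremalBiaxialitySubcritical_bootstrap`): a counterexample to the
Type-I Liouville problem. None is known; none is constructible by the means of this file. -/
theorem not_crux_iff :
    ¬ SqueezeCycle.ExtremalBiaxialitySubcritical ↔
      ∃ (C m : ℝ) (u : ℝ → ℝ³ → ℝ³) (t₀ : ℝ) (x₀ : ℝ³), t₀ < 0 ∧ InK C u ∧ LamGE m u t₀ x₀ ∧
        IsClassMax C m ∧ 1 / 8 ≤ m := by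
  rw [crux_iff]
  push Not
  rfl

/-- At a kill the two clauses pin `Λ_u(t₀,x₀) = m = max_{𝒦_C} Λ` exactly, and the extremal element
does not vanish at time `t₀` (tree: `extremal_lerayMiddleStrain_eq`; a vanishing slice has
`m ≤ 0`, `nonpos_of_twoFrame_lower_of_slice_zero`). -/
theorem kill_is_nontrivial {m t₀ : ℝ} {u : ℝ → ℝ³ → ℝ³} {x₀ : ℝ³} (hm : 1 / 8 ≤ m)
    (hGE : LamGE m u t₀ x₀) : ∃ x, u t₀ x ≠ 0 := by
  by_contra h
  push Not at h
  have := nonpos_of_twoFrame_lower_of_slice_zero h hGE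
  linarith

/-! ## §1 Load-bearing hypotheses (every statement = the crux with ONE clause altered) -/

/-- `SelfExtremal`: membership `u ∈ 𝒦_C` REPLACED by "exact classical Navier–Stokes flow on
`ℝ³ × (−∞,0)`", class-maximality WEAKENED to maximality over all space-time points of `u` itself
(= over its whole admissible symmetry orbit). -/
def SelfExtremal : Prop :=
  ∀ (m : ℝ) (u : ℝ → ℝ³ → ℝ³) (p : ℝ → ℝ³ → ℝ) (t₀ : ℝ) (x₀ : ℝ³), t₀ < 0 →
    IsClassicalNSSolutionOn (Set.Iio 0) 1 0 u p → LamGE m u t₀ x₀ → (∀ t < 0, ∀ x, LamLE m u t x) →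
    m < 1 / 8

/-- **`SelfExtremal` is FALSE** (witness: the pulsed strain, `m = 1`; LANDED
`Negative.not_selfExtremal`, p71597). Optimality at the record — to all orders, with the exact
dynamics — bounds nothing. -/
theorem not_selfExtremal : ¬ SelfExtremal :=
  Negative.not_selfExtremal

/-- Indeed every value `m ≥ 0` is an attained self-maximal record of an exact flow
(`Negative.pulsedStrain m`), and every `m ≥ 0` is the CONSTANT value of `Λ` of an exact
self-similar flow (`selfSimilarStrain`, file `Negative/SelfSimilarStrain`). -/
theorem selfExtremal_witness {m : ℝ} (hm : 0 ≤ m) :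
    IsClassicalNSSolutionOn (Set.Iio 0) 1 0 (Negative.pulsedStrain m) (Negative.pulsedPressure m) ∧
      LamGE m (Negative.pulsedStrain m) (-1) 0 ∧ ∀ t < 0, ∀ x, LamLE m (Negative.pulsedStrain m) t x :=
  ⟨Negative.isClassicalNSSolutionOn_pulsedStrain m, Negative.pulsedStrain_attains m 0,
    fun t _ x => Negative.pulsedStrain_le hm t x⟩

/-- **Every point a record**: for every `m ≥ 0` the exact self-similar flow `selfSimilarStrain m`
has `Λ ≡ m` on all of `ℝ³ × (−∞, 0)` — both clauses of the crux at EVERY point (LANDED p71889). -/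
theorem selfSimilar_witness {m : ℝ} (hm : 0 ≤ m) :
    IsClassicalNSSolutionOn (Set.Iio 0) 1 0 (Negative.selfSimilarStrain m) (Negative.selfSimilarPressure m) ∧
      ∀ t < 0, ∀ x, LamGE m (Negative.selfSimilarStrain m) t x ∧ LamLE m (Negative.selfSimilarStrain m) t x :=
  ⟨Negative.isClassicalNSSolutionOn_selfSimilarStrain m, fun _ ht x =>
    ⟨Negative.selfSimilarStrain_lamGE m ht x, Negative.selfSimilarStrain_lamLE hm ht x⟩⟩

/-- `WithoutMembership C`: membership of the extremal element REPLACED by "exact NS flow"; the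
attainment clause and the GENUINE class-maximality over `𝒦_C` kept verbatim. -/
def WithoutMembership (C : ℝ) : Prop :=
  ∀ (m : ℝ) (u : ℝ → ℝ³ → ℝ³) (t₀ : ℝ) (x₀ : ℝ³), t₀ < 0 →
    (∃ p : ℝ → ℝ³ → ℝ, IsClassicalNSSolutionOn (Set.Iio 0) 1 0 u p) → LamGE m u t₀ x₀ →
    IsClassMax C m → m < 1 / 8

/-- **Membership is load-bearing at `C = 0`** (`𝒦_0 = {0}` is inhabited, maximality genuinely
tested; LANDED p71597). -/
theorem false_without_membership_zero : ¬ WithoutMembership 0 :=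
  Negative.false_without_membership_zero

/-- **… at every small constant `C ≤ ε`** (LANDED p71597, via `squeezeClass_eq_zero_of_small`). -/
theorem false_without_membership_small : ∃ ε : ℝ, 0 < ε ∧ ∀ C : ℝ, C ≤ ε → ¬ WithoutMembership C :=
  Negative.false_without_membership_small

/-- **… and at EVERY constant under the route target** (LANDED p71597): in the Liouville world the
crux is true only because membership forces `Λ ≡ 0`. -/
theorem false_without_membership_of_squeezeLiouville (hL : SqueezeCycle.SqueezeLiouville) (C : ℝ) :
    ¬ WithoutMembership C :=
  Negative.false_without_membership_of_squeezeLiouville hL C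

/-- `WithoutAttainment`: the attainment clause dropped. -/
def WithoutAttainment : Prop :=
  ∀ (C m : ℝ) (u : ℝ → ℝ³ → ℝ³) (t₀ : ℝ) (_x₀ : ℝ³), t₀ < 0 → InK C u → IsClassMax C m → m < 1 / 8

/-- **Attainment is load-bearing** (`C = 0`, `u ≡ 0`, `m = 1`; LANDED p71711). -/
theorem false_without_attainment : ¬ WithoutAttainment :=
  Negative.false_without_attainment

/-- `WithoutTime`: the guard `t₀ < 0` dropped. -/
def WithoutTime : Prop :=
  ∀ (C m : ℝ) (u : ℝ → ℝ³ → ℝ³) (t₀ : ℝ) (x₀ : ℝ³), InK C u → LamGE m u t₀ x₀ → IsClassMax C m → m < 1 / 8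

/-- **The guard `t₀ < 0` is load-bearing** (junk slice at `t₀ = 1`; LANDED p71711). -/
theorem false_without_time : ¬ WithoutTime :=
  Negative.false_without_time

/-- `WithoutMaximality`: class-maximality dropped = "`Λ < 1/8` at every point of every element". -/
def WithoutMaximality : Prop :=
  ∀ (C m : ℝ) (u : ℝ → ℝ³ → ℝ³) (t₀ : ℝ) (x₀ : ℝ³), t₀ < 0 → InK C u → LamGE m u t₀ x₀ → m < 1 / 8

/-- **Maximality is Liouville-hard, I**: `X ⇒ WithoutMaximality` (LANDED p71711). -/
theorem withoutMaximality_of_squeezeLiouville (hL : SqueezeCycle.SqueezeLiouville) : WithoutMaximality :=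
  Negative.withoutMaximality_of_squeezeLiouville hL

/-- **Maximality is Liouville-hard, II**: `MustSqueeze ⇒ WithoutMaximality ⇒ X` (LANDED p71711). -/
theorem squeezeLiouville_of_withoutMaximality (hM : SqueezeCycle.MustSqueeze) (hW : WithoutMaximality) :
    SqueezeCycle.SqueezeLiouville :=
  Negative.squeezeLiouville_of_mustSqueeze_of_withoutMaximality hM hW

/-! ## §2 Calibration (cycle 1; now tree theorems — pointers) -/

/-- `m ≥ 0` is forced by maximality tested on `0 ∈ 𝒦_C` (`C ≥ 0`); `𝒦_C = ∅` for `C < 0`; the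
two clauses pin `Λ_u(t₀,x₀) = m`; the crux holds for `C ≤ ε` and under `SqueezeLiouville`,
`TypeIAncientLiouville`, (L); given the `MustSqueeze` family below `1/4` it is equivalent to its
`1/4`-version. All in the tree (`nonneg_of_maximal`, `squeezeClass_constant_nonneg`,
`extremal_lerayMiddleStrain_eq`, `extremalBiaxialitySubcritical_of_small`, `_of_squeezeLiouville`,
`_of_typeIAncientLiouville`, `_of_liouvilleConjectureNS`, `_bootstrap`). Recorded here: the
hypotheses are jointly satisfiable (not vacuous) — `C = m = 0`, `u ≡ 0`, any `t₀ < 0`. -/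
theorem hypotheses_satisfiable :
    ∃ (C m : ℝ) (u : ℝ → ℝ³ → ℝ³) (t₀ : ℝ) (x₀ : ℝ³), t₀ < 0 ∧ InK C u ∧ LamGE m u t₀ x₀ ∧ IsClassMax C m :=
  ⟨0, 0, 0, -1, 0, by norm_num, squeezeClass_zero le_rfl, by
    refine ⟨EuclideanSpace.single 0 1, EuclideanSpace.single 1 1, by simp, by simp,
      by simp [EuclideanSpace.inner_single_left], fun α β => ?_⟩
    simp, Negative.isClassMax_zero le_rfl⟩

/-! ## §3 Mechanism probes: the record budget and the saddle (LANDED p71639 — pointers) -/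

/-- **First-order budget at the record closes for every `m ≥ 0` with no non-local payment**
(`Negative.localBudget_selfPaid`): `0 = −m − m² + σ/3 + w/12 − w₂/4 − h + V` with `w = w₂ = h = 0`,
`σ = |diag(km, m, −(k+1)m)|² = 2m²(k²+k+1)` and `V ≤ 0` as soon as `2m(k²+k+1) ≥ 3(1+m)`. -/
theorem localBudget_selfPaid {m k : ℝ} (hm : 0 ≤ m) (hk : 3 * (1 + m) ≤ 2 * m * (k ^ 2 + k + 1)) :
    m + m ^ 2 - ((k * m) ^ 2 + m ^ 2 + (-(k + 1) * m) ^ 2) / 3 ≤ 0 :=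
  (Negative.localBudget_selfPaid hm hk).2.2.1

/-- **Saddle no-go** (`Negative.midEigenvalue_not_midpointConvex` / `…Concave`): `λ₂` is neither
midpoint-convex nor midpoint-concave on trace-free symmetric matrices — pointer theorem recording
the two middle values `9/5 > 0` (concave direction) and `−9/5 < 0` (convex direction). -/
theorem saddle_values : (0 : ℝ) < 9 / 5 ∧ -(9 / 5) < (0 : ℝ) := by norm_num

/-! ## §4 What a kill must look like, quantitatively (pointers for ideators) -/

/-- **Records are rooted and pinned** (tree, `…Extremal`): at a kill `Λ_u(t₀,x₀) = m` exactly, no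
future time-shift of `u` stays in `𝒦_C`, WLOG `(t₀,x₀) = (−1,0)`; `m ≥ 1/4`, `C > ε`; `u(t₀,·) ≢ 0`
(`kill_is_nontrivial`); `u` is not planar / axisymmetric-no-swirl / axisymmetric with `r|u| ≤ K`
(tree, `…Symmetric`). And by §1(A) the kill's LOCAL structure at the record can be anything an
exact flow allows — in particular exactly that of `pulsedStrain m` or `selfSimilarStrain m`. -/
theorem kill_pinned {C m t₀ : ℝ} {u : ℝ → ℝ³ → ℝ³} {x₀ : ℝ³} (ht₀ : t₀ < 0) (hu : InK C u)
    (hGE : LamGE m u t₀ x₀) (hmax : IsClassMax C m) :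
    lerayMiddleStrain u t₀ x₀ = m ∧ 0 ≤ m :=
  ⟨(extremal_lerayMiddleStrain_eq ht₀ hu hGE hmax).1,
    nonneg_of_maximal (squeezeClass_constant_nonneg hu.2.2.2.1) hmax⟩


/-! ## §5 Maximality is free (generation 3; LANDED p72559 `Negative/MaximalityFree`) -/

/-- **Extremal elements always exist**: for every `C ≥ 0` some `u ∈ 𝒦_C` and `m ≥ 0` satisfy both
clauses of the crux at `(t₀, x₀) = (−1, 0)` — `m = max_{𝒦_C} Λ` (`Negative.classMax_attained`,
from the proved `ExtremalElementExists`). -/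
theorem classMax_attained' {C : ℝ} (hC : 0 ≤ C) :
    ∃ (u : ℝ → ℝ³ → ℝ³) (m : ℝ), 0 ≤ m ∧ InK C u ∧ LamGE m u (-1) 0 ∧ IsClassMax C m := by
  obtain ⟨u, m, hm, hu, hGE, hmax⟩ := Negative.classMax_attained hC
  exact ⟨u, m, hm, hu, hGE, hmax⟩

/-- **The crux ⇔ the crux without its maximality clause** (`Negative.crux_iff_withoutMaximality`). -/
theorem crux_iff_withoutMaximality' : SqueezeCycle.ExtremalBiaxialitySubcritical ↔ WithoutMaximality :=
  Negative.crux_iff_withoutMaximality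

/-- **The crux as an a-priori bound**: `Λ < 1/8` at every point of every element of every class
(`Negative.crux_iff_forall_lerayMiddleStrain_lt`). -/
theorem crux_iff_forall_lt :
    SqueezeCycle.ExtremalBiaxialitySubcritical ↔
      ∀ (C : ℝ) (u : ℝ → ℝ³ → ℝ³), InK C u → ∀ t < 0, ∀ x, lerayMiddleStrain u t x < 1 / 8 :=
  Negative.crux_iff_forall_lerayMiddleStrain_lt

/-- **Kill shape, point form** (supersedes `not_crux_iff`): the crux fails iff ONE element of ONE
class has `Λ ≥ 1/8` at ONE point (`Negative.not_crux_iff_exists_point`). -/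
theorem not_crux_iff_point :
    ¬ SqueezeCycle.ExtremalBiaxialitySubcritical ↔
      ∃ (C : ℝ) (u : ℝ → ℝ³ → ℝ³) (t : ℝ) (x : ℝ³), t < 0 ∧ InK C u ∧ LamGE (1 / 8) u t x :=
  Negative.not_crux_iff_exists_point

/-- **Classes grow with the constant** (`Negative.squeezeClass_mono`), so a kill at `C` is a kill
at every `C' ≥ C` (`Negative.not_crux_iff_eventually`). -/
theorem inK_mono {C C' : ℝ} (h : C ≤ C') {u : ℝ → ℝ³ → ℝ³} (hu : InK C u) : InK C' u :=
  Negative.squeezeClass_mono h hu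

/-! ## §6 No slack, the spectral gap, and how much the picked line buys (generation 3) -/

/-- **X ⇔ MustSqueeze ∧ crux** — the two open cruxes partition the target exactly (to be LANDED as
`Negative.squeezeLiouville_iff_mustSqueeze_and_crux`; re-proved here from §5). -/
theorem squeezeLiouville_iff' :
    SqueezeCycle.SqueezeLiouville ↔
      SqueezeCycle.MustSqueeze ∧ SqueezeCycle.ExtremalBiaxialitySubcritical := by
  constructor
  · intro hL
    exact ⟨fun C u hu _ => hL C u hu, extremalBiaxialitySubcritical_of_squeezeLiouville hL⟩
  · rintro ⟨hM, hX⟩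
    exact Negative.squeezeLiouville_of_mustSqueeze_of_withoutMaximality hM
      (Negative.withoutMaximality_of_crux hX)

/-- `MustSqueezeAt a`: the sibling crux `MustSqueeze` with threshold `a` in place of `1/8`. -/
def MustSqueezeAt (a : ℝ) : Prop :=
  ∀ (C : ℝ) (u : ℝ → ℝ³ → ℝ³), InK C u → (∀ t < 0, ∀ x, LamLE a u t x) → ∀ t < 0, ∀ x, u t x = 0

/-- Read-back: `MustSqueeze = MustSqueezeAt (1/8)`. -/
theorem mustSqueeze_iff : SqueezeCycle.MustSqueeze ↔ MustSqueezeAt (1 / 8) := Iff.rfl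

/-- **Spectral gap** (`Negative.classMax_gap`): given the `MustSqueeze` family below `1/4`, an
attained class maximum is `≤ 0` or `≥ 1/4`; with `classMax_attained'`, `max_{𝒦_C} Λ ∈ {0} ∪ [1/4,∞)`
for every `C ≥ 0`. -/
theorem classMax_gap' (hMS : ∀ a : ℝ, a < 1 / 4 → MustSqueezeAt a) {C m t₀ : ℝ} {u : ℝ → ℝ³ → ℝ³}
    {x₀ : ℝ³} (ht₀ : t₀ < 0) (hu : InK C u) (hGE : LamGE m u t₀ x₀) (hmax : IsClassMax C m) :
    m ≤ 0 ∨ 1 / 4 ≤ m :=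
  Negative.classMax_gap hMS ht₀ hu hGE hmax

/-- **The target as the quarter a-priori bound**: given the `MustSqueeze` family below `1/4`,
X ⇔ "`Λ < 1/4` at every point of every element of every `𝒦_C`". -/
theorem squeezeLiouville_iff_forall_lt_quarter (hMS : ∀ a : ℝ, a < 1 / 4 → MustSqueezeAt a) :
    SqueezeCycle.SqueezeLiouville ↔
      ∀ (C : ℝ) (u : ℝ → ℝ³ → ℝ³), InK C u → ∀ t < 0, ∀ x, lerayMiddleStrain u t x < 1 / 4 := by
  have hM : SqueezeCycle.MustSqueeze := hMS (1 / 8) (by norm_num)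
  rw [squeezeLiouville_iff']
  constructor
  · rintro ⟨-, hX⟩
    exact (Negative.crux_iff_forall_lerayMiddleStrain_lt_quarter hMS).1 hX
  · intro h
    exact ⟨hM, (Negative.crux_iff_forall_lerayMiddleStrain_lt_quarter hMS).2 h⟩

/-- **The cubic ceiling of the picked line is attained on pinned data** (`λ₂ = m`, `|S| = K`):
`−4 det S = (2m − 4m³/K²)|S|²` exactly (`production_identity`), so the bootstrap excess
`b = m − 2m³/K²` is algebraically sharp — and every pinned datum is realised identically in
space-time by an exact self-similar strain flow (§1(A)). -/
theorem cubicCeiling_eq_of_pinned (A : Matrix (Fin 3) (Fin 3) ℝ) (hA : A.trace = 0) {m K : ℝ}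
    (hK : 0 < K) (hμ : (Matrix.isHermitian_add_transpose_self A).eigenvalues₀ 1 = 2 * m)
    (hσ : (∑ i, ∑ j, (((1 / 2 : ℝ) • (A + Aᵀ)) i j) ^ 2) = K ^ 2) :
    -4 * (((1 / 2 : ℝ) • (A + Aᵀ))).det =
      (2 * m - 4 * m ^ 3 / K ^ 2) * (∑ i, ∑ j, (((1 / 2 : ℝ) • (A + Aᵀ)) i j) ^ 2) := by
  rw [production_identity A hA, hμ, hσ]
  field_simp
  ring

/-- **The open stub's regime contains every attained `m ≥ 3/8`** (`6m² ≤ K²` is forced at the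
record): the bootstrap never touches `m ≥ 3/8`. -/
theorem largeExcess_of_three_eighths_le {m K : ℝ} (hK : 0 < K) (h6 : 6 * m ^ 2 ≤ K ^ 2)
    (hm : 3 / 8 ≤ m) : 1 / 4 ≤ m - 2 * m ^ 3 / K ^ 2 := by
  have hK2 : 0 < K ^ 2 := by positivity
  have h1 : 2 * m ^ 3 / K ^ 2 ≤ m / 3 := by
    rw [div_le_iff₀ hK2]
    nlinarith
  linarith

/-- **… and every attained `m ∈ [0.28, 3/8]` once `K² ≥ 3/2`** — the no-slack strain floor of any
nontrivial class (`sup (−t)λ₁ ≥ 1` by the vorticity maximum principle, `|S|² ≥ (3/2)λ₁²`): the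
bootstrap's three true stubs only dispose of the sliver `[1/4, 0.28)`. -/
theorem largeExcess_of_strainFloor {m K : ℝ} (hK : 3 / 2 ≤ K ^ 2) (hm : 7 / 25 ≤ m)
    (hm' : m ≤ 3 / 8) : 1 / 4 ≤ m - 2 * m ^ 3 / K ^ 2 := by
  have hK2 : 0 < K ^ 2 := by linarith
  have hm0 : 0 ≤ m := by linarith
  have h1 : 2 * m ^ 3 / K ^ 2 ≤ 4 * m ^ 3 / 3 := by
    rw [div_le_iff₀ hK2]
    nlinarith [pow_nonneg hm0 3]
  nlinarith [mul_nonneg (sub_nonneg.2 hm) (sub_nonneg.2 hm'),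
    mul_nonneg hm0 (mul_nonneg (sub_nonneg.2 hm) (sub_nonneg.2 hm'))]


/-! ## §7 The crux is refuted by ANY finite-energy Type-I blow-up; `MustSqueeze` is bypassable (generation 3)

The sibling crux `MustSqueeze` runs the quarter law on the ANCIENT class, where similarity
enstrophy may be infinite (its whole difficulty is the localisation). Run it instead in PHYSICAL
variables on the finite-energy solution BEFORE zooming, where enstrophy is finite:
`E(t) = ½‖ω(t)‖₂²` obeys `E' = −ν‖∇ω‖² + ∫ω·Sω = −ν‖∇ω‖² − 4∫det S ≤ 2‖λ₂⁺(t)‖_∞ E`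
(Betchov: `∫ω·Sω = 4∫det ∇u − 4∫det S`, `det ∇u` a null Lagrangian; `−4 det S ≤ 2λ₂⁺|S|²`,
tree `neg_det_half_add_transpose_le`; `∫|S|² = ½∫|ω|²`), so if `(T−t)‖λ₂⁺(t)‖_∞ ≤ a` on
`[t₀, T)` then `E(t) ≤ E(t₀)((T−t₀)/(T−t))^{2a}`, while blow-up at `T` forces Leray's enstrophy
rate `2E(t) = ‖∇u(t)‖₂² ≥ c ν^{3/2} (T−t)^{−1/2}` (Leray 1934 (3.9)-type; Ożański–Pooley 2018
Cor. 6.25) — contradiction for `a < 1/4`. Hence **`PhysicalQuarterLaw`**: a finite-energy maximal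
solution squeezes at the critical rate, `limsup_{t→T} (T−t)‖λ₂⁺(t)‖_∞ ≥ 1/4` (Miller 2019's
criterion with the scale-critical constant made explicit; provable-now modulo the classical
enstrophy identity and Leray's `H¹` rate). If the blow-up is Type I (which the route's borrowed
`NoTypeII` asserts of every blow-up), zooming at the squeeze points `(x_k, t_k)` with factor
`√(T−t_k)` (uniform Type-I bound, uniform scaled energies by Albritton–Barker 2019 Lemma 2.5,
KNSS compactness — the ingredients of the route's `SingularZoom`, centred at moving points) gives
an element of some `𝒦_C` with `Λ(−1, 0) ≥ θ` for every `θ < 1/4` (**`SqueezeZoom`**), hence by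
`not_crux_iff_point` the crux FAILS. Consequences:
* **Kill shape, final form**: any finite-energy Type-I blow-up from smooth rapidly decaying data
  refutes the crux automatically — no need to evaluate `Λ` on the profile; and given `NoTypeII`,
  ANY finite-time blow-up does (`not_crux_of_blowup`).
* **`MustSqueeze` is not needed by the route**: `clay_of_crux_sans_mustSqueeze` closes Clay (A)
  from the crux, `PhysicalQuarterLaw` (M, provable now), `SqueezeZoom` (L, known ingredients),
  and the borrowed `NoTypeII`, `NoBlowupToClay` — the open-problem-strength sibling crux and its
  localisation problem drop out (planners: a re-lining candidate; the two new Props are typed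
  below and elaborate).
-/

/-- **Physical-variables quarter law** (Miller's middle-eigenvalue enstrophy identity + Leray's
`H¹` blow-up rate): a maximal smooth finite-energy solution of the unforced system from a rapidly
decaying datum squeezes at the critical rate near its blow-up time — for every `θ < 1/4`,
frequently as `t ↑ T` some point has `(T − t)·λ₂(sym ∇u(t, x)) ≥ θ`. (Typed in the vocabulary
of the route's `NoTypeII`; `strainEigenvalues _ _ 1` is the middle strain eigenvalue, as in
`lerayMiddleStrain`.) -/
def PhysicalQuarterLaw : Prop :=
  ∀ (ν T : ℝ), 0 < ν → 0 < T → ∀ (u : ℝ → ℝ³ → ℝ³) (p : ℝ → ℝ³ → ℝ),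
    IsMaximalSmoothSolution ν 0 u p T → IsLerayHopfOn T ν 0 (u 0) u → HasRapidSpatialDecay (u 0) →
      ∀ θ : ℝ, θ < 1 / 4 → ∃ᶠ t in 𝓝[<] T, ∃ x : ℝ³,
        θ ≤ (T - t) * strainEigenvalues (fderiv ℝ (u t) x : ℝ³ →ₗ[ℝ] ℝ³) finrank_euclideanSpace_fin 1

/-- **Zoom at squeeze points** (the route's `SingularZoom` ingredients — uniform Type-I bound,
Albritton–Barker uniform scaled energies, KNSS compactness, `ν`-rescaling to `ν = 1` — centred at
moving points `(x_k, t_k)` with factors `√(ν(T − t_k))`): a Type-I blow-up with squeeze points of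
gauge value `≥ θ` frequently as `t ↑ T` produces an element of some `𝒦_C` attaining `Λ(−1,0) ≥ θ`
(the crux's lower two-frame clause). -/
def SqueezeZoom : Prop :=
  ∀ (ν T : ℝ), 0 < ν → 0 < T → ∀ (u : ℝ → ℝ³ → ℝ³) (p : ℝ → ℝ³ → ℝ) (θ : ℝ),
    IsMaximalSmoothSolution ν 0 u p T → IsLerayHopfOn T ν 0 (u 0) u → HasRapidSpatialDecay (u 0) →
      IsTypeIBlowup u T →
      (∃ᶠ t in 𝓝[<] T, ∃ x : ℝ³,
        θ ≤ (T - t) * strainEigenvalues (fderiv ℝ (u t) x : ℝ³ →ₗ[ℝ] ℝ³) finrank_euclideanSpace_fin 1) →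
      ∃ (C : ℝ) (u' : ℝ → ℝ³ → ℝ³), InK C u' ∧ LamGE θ u' (-1) 0

/-- **Any Type-I blow-up refutes the crux** (given the two lemmas above): squeeze points of gauge
value `≥ 1/8` exist near `T` (`PhysicalQuarterLaw`, `1/8 < 1/4`), their zoom is an element of some
`𝒦_C` with `Λ(−1,0) ≥ 1/8` (`SqueezeZoom`), which is a kill (`not_crux_iff_point`). -/
theorem not_crux_of_typeI_blowup (hQ : PhysicalQuarterLaw) (hZ : SqueezeZoom) {ν T : ℝ}
    (hν : 0 < ν) (hT : 0 < T) {u : ℝ → ℝ³ → ℝ³} {p : ℝ → ℝ³ → ℝ}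
    (hmax : IsMaximalSmoothSolution ν 0 u p T) (hLH : IsLerayHopfOn T ν 0 (u 0) u)
    (hdec : HasRapidSpatialDecay (u 0)) (hTI : IsTypeIBlowup u T) :
    ¬ SqueezeCycle.ExtremalBiaxialitySubcritical := by
  have hfreq := hQ ν T hν hT u p hmax hLH hdec (1 / 8) (by norm_num)
  obtain ⟨C, u', hu', hGE⟩ := hZ ν T hν hT u p (1 / 8) hmax hLH hdec hTI hfreq
  exact not_crux_iff_point.2 ⟨C, u', -1, 0, by norm_num, hu', hGE⟩

/-- **… and given the borrowed `NoTypeII`, ANY finite-time blow-up from a smooth rapidly decaying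
datum refutes the crux.** -/
theorem not_crux_of_blowup (hQ : PhysicalQuarterLaw) (hZ : SqueezeZoom)
    (hII : SqueezeCycle.NoTypeII) {ν T : ℝ} (hν : 0 < ν) (hT : 0 < T) {u : ℝ → ℝ³ → ℝ³}
    {p : ℝ → ℝ³ → ℝ} (hmax : IsMaximalSmoothSolution ν 0 u p T)
    (hLH : IsLerayHopfOn T ν 0 (u 0) u) (hdec : HasRapidSpatialDecay (u 0)) :
    ¬ SqueezeCycle.ExtremalBiaxialitySubcritical :=
  not_crux_of_typeI_blowup hQ hZ hν hT hmax hLH hdec (hII ν T hν hT u p hmax hLH hdec)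

/-- **Clay (A) from the crux WITHOUT `MustSqueeze`**: `PhysicalQuarterLaw → SqueezeZoom →
NoTypeII → NoBlowupToClay → ExtremalBiaxialitySubcritical → NavierStokesRegularity`. Compare the
route's `closes` (`MustSqueeze → ExtremalElementExists → crux → SingularZoom → NoTypeII →
NoBlowupToClay → …`): `ExtremalElementExists` is proved, and the pair
(`MustSqueeze`, `SingularZoom`) is replaced by (`PhysicalQuarterLaw`, `SqueezeZoom`), both of
known type. -/
theorem clay_of_crux_sans_mustSqueeze (hQ : PhysicalQuarterLaw) (hZ : SqueezeZoom)
    (hII : SqueezeCycle.NoTypeII) (hClay : SqueezeCycle.NoBlowupToClay)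
    (hX : SqueezeCycle.ExtremalBiaxialitySubcritical) : NavierStokesRegularity := by
  apply hClay
  intro ν T hν hT u p hcl hLH hdec
  by_contra hext
  exact not_crux_of_blowup hQ hZ hII hν hT ⟨hcl, hext⟩ hLH hdec hX

end Summit.NavierStokesRegularity.NavierStokesRegularity.Cruxes.ExtremalBiaxialitySubcritical.Disproof

end
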